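import Summits.Ventures.PercRepro.C026HubAttachF

/-!
# Hub attachment and the D-free inequality, VII: the weight of a join and the per-base inequality (p5, gen 10)

* **`sigOf`** — the signature `(SigA, SigB, SigLink)` of a hub part, **`evOf`** — the five base events
  `(P, Q, B, CK, CL)` of a base;
* **`starWeight_join`** — on a `bot` base `β` with a single-direction hub part `σ` the (★)-weight of
  `β ⊔ σ` is `tbl (sigOf σ) (evOf β)`, and it is `0` otherwise;
* **`starWeight_base`** — the (★)-weight of the base is its own table entry `g₀₀₀`;
* **`sum_starWeight_join_ge`** — the PER-BASE INEQUALITY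
  `(N₀₀₀ + N₀₀₁) · w(β) ≤ Σ_σ w(β ⊔ σ)` from `N₀₀₁ ≤ N₁₀₀`, `N₀₀₁ ≤ N₀₁₀` (hypotheses, proved in
  `C026HubAttachH.lean`) and the Boolean inequality `g₀₀₁ + g₁₀₀ + g₀₁₀ ≥ g₀₀₀`.
-/

namespace PercRepro

namespace MultiGraph

variable {V E : Type*} {G : MultiGraph V E}

section Signature

variable (G)

open Classical in
/-- The signature of a hub part: `(SigA, SigB, SigLink)`. -/
noncomputable def sigOf (Hs : Set V) (a b c : V) (σ : Config E) : Bool × Bool × Bool :=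
  (decide (G.SigM Hs ∅ σ a c), decide (G.SigM Hs ∅ σ b c), decide (G.SigLink Hs ∅ σ a b c))

open Classical in
/-- The five base events: `P = c ~_H a` avoiding `L₀`, `Q = c ~_H b` avoiding `K₀`, `B = a ~_H b`,
`CK = c ~_H a`, `CL = c ~_H b`. -/
noncomputable def evOf (a b c : V) (β : Config E) : Bool × Bool × Bool × Bool × Bool :=
  (decide (G.HConnAvoid β c (G.cluster β b) c a), decide (G.HConnAvoid β c (G.cluster β a) c b),
    decide (G.HConn β c a b), decide (G.HConn β c a c), decide (G.HConn β c b c))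

/-- The table evaluated on a signature and an event vector. -/
def tblAt (s : Bool × Bool × Bool) (ev : Bool × Bool × Bool × Bool × Bool) : ℤ :=
  tbl s.1 s.2.1 s.2.2 ev.1 ev.2.1 ev.2.2.1 ev.2.2.2.1 ev.2.2.2.2

/-- The truncated table on a signature and an event vector. -/
def tblLowAt (s : Bool × Bool × Bool) (ev : Bool × Bool × Bool × Bool × Bool) : ℤ :=
  tblLow s ev.1 ev.2.1 ev.2.2.1 ev.2.2.2.1 ev.2.2.2.2

variable {G}

/-- `tblLowAt ≤ tblAt`. -/
theorem tblLowAt_le (s : Bool × Bool × Bool) (ev : Bool × Bool × Bool × Bool × Bool) :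
    tblLowAt s ev ≤ tblAt s ev :=
  tblLow_le_tbl s _ _ _ _ _

end Signature

section WeightJoin

variable {Hs : Set V} {a b c : V} {β σ : Config E}

/-- `c ~_H a` and `c ~_H b` give `a ~_H b`. -/
theorem hConn_ab_of_ca_cb (hca : G.HConn β c a c) (hcb : G.HConn β c b c) : G.HConn β c a b :=
  hca.trans (G.hConn_symm hcb)

variable (hH : G.IsHubSet Hs a b c) (hβ : Frozen (G.edgesAt Hs) β) (hσ : G.HubOnly Hs σ)
include hH hβ hσ

open Classical in
/-- **The (★)-weight of a join** is the table entry on a `bot` base with a single-direction hub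
part, and `0` otherwise. -/
theorem starWeight_join :
    G.starWeight a b c (join β σ) =
      if G.IsBot β a b c ∧ G.SingleDir Hs a b c σ then tblAt (G.sigOf Hs a b c σ) (G.evOf a b c β)
      else 0 := by
  classical
  have hbase : G.baseOf Hs (join β σ) = β := baseOf_join hβ hσ
  have hbotiff : G.IsBot (join β σ) a b c ↔ G.IsBot β a b c ∧ G.SingleDir Hs a b c σ := by
    rw [hH.isBot_iff_base (join β σ), hbase, singleDir_join_iff hβ]
  unfold starWeight
  by_cases hb : G.IsBot β a b c ∧ G.SingleDir Hs a b c σ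
  · have hbot : G.IsBot (join β σ) a b c := hbotiff.2 hb
    rw [if_pos hbot, if_pos hb]
    have h1 := hH.hConnAvoid_ca_iff hbot
    have h2 := hH.hConnAvoid_cb_iff hbot
    have h3 := hH.hConn_ab_iff hbot
    rw [hbase, sigM_join_iff hβ] at h1
    rw [hbase, sigM_join_iff hβ] at h2
    rw [hbase, sigM_join_iff hβ, sigM_join_iff hβ, sigLink_join_iff hβ] at h3
    simp only [tblAt, tbl, sigOf, evOf, Bool.or_eq_true, Bool.and_eq_true, decide_eq_true_iff, h1,
      h2, h3]
  · rw [if_neg (fun h => hb (hbotiff.1 h)), if_neg hb]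

omit hH hβ hσ in
/-- **The (★)-weight of a `bot` base is its table entry `g₀₀₀`**. -/
theorem starWeight_base (hbot : G.IsBot β a b c) :
    G.starWeight a b c β = tblAt (false, false, false) (G.evOf a b c β) := by
  classical
  unfold starWeight
  rw [if_pos hbot]
  have hB : (G.HConn β c a b ∨ (G.HConn β c a c ∧ G.HConn β c b c)) ↔ G.HConn β c a b :=
    ⟨fun h => h.elim id (fun h => hConn_ab_of_ca_cb h.1 h.2), fun h => Or.inl h⟩
  simp only [tblAt, tbl, evOf, Bool.or_eq_true, Bool.and_eq_true, decide_eq_true_iff, Bool.false_or,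
    Bool.or_false, hB]

end WeightJoin

/-! ### The per-base inequality -/

section PerBase

variable [Fintype E] [DecidableEq E] {Hs : Set V} {a b c : V}

open Classical in
/-- The number of single-direction hub parts of a given signature. -/
noncomputable def sigCount (G : MultiGraph V E) (Hs : Set V) (a b c : V) (s : Bool × Bool × Bool) :
    ℕ :=
  (Finset.univ.filter fun σ : Config E =>
    G.HubOnly Hs σ ∧ G.SingleDir Hs a b c σ ∧ G.sigOf Hs a b c σ = s).card

open Classical in
/-- The truncated sum over the single-direction hub parts is the signature-count combination. -/
theorem sum_tblLowAt (ev : Bool × Bool × Bool × Bool × Bool) :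
    ∑ σ ∈ Finset.univ.filter (fun σ : Config E => G.HubOnly Hs σ ∧ G.SingleDir Hs a b c σ),
        tblLowAt (G.sigOf Hs a b c σ) ev =
      (G.sigCount Hs a b c (false, false, false) : ℤ) * tblAt (false, false, false) ev +
        (G.sigCount Hs a b c (false, false, true) : ℤ) * tblAt (false, false, true) ev +
          (G.sigCount Hs a b c (true, false, false) : ℤ) * tblAt (true, false, false) ev +
            (G.sigCount Hs a b c (false, true, false) : ℤ) * tblAt (false, true, false) ev := by
  simp only [tblLowAt, tblLow, tblAt, Finset.sum_add_distrib, ← Finset.sum_mul, Finset.sum_boole,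
    sigCount, Finset.filter_filter, and_assoc]

open Classical in
/-- **The per-base inequality**: `(N₀₀₀ + N₀₀₁) · w(β) ≤ Σ_σ w(β ⊔ σ)`, given `N₀₀₁ ≤ N₁₀₀` and
`N₀₀₁ ≤ N₀₁₀`. -/
theorem sum_starWeight_join_ge (hH : G.IsHubSet Hs a b c)
    (hN1 : G.sigCount Hs a b c (false, false, true) ≤ G.sigCount Hs a b c (true, false, false))
    (hN2 : G.sigCount Hs a b c (false, false, true) ≤ G.sigCount Hs a b c (false, true, false))
    {β : Config E} (hβ : Frozen (G.edgesAt Hs) β) :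
    ((G.sigCount Hs a b c (false, false, false) + G.sigCount Hs a b c (false, false, true) : ℕ) : ℤ) *
        G.starWeight a b c β ≤
      ∑ σ ∈ Finset.univ.filter (fun σ : Config E => G.HubOnly Hs σ),
        G.starWeight a b c (join β σ) := by
  by_cases hbot : G.IsBot β a b c
  · -- every summand is a table entry
    have hterm : ∀ σ ∈ Finset.univ.filter (fun σ : Config E => G.HubOnly Hs σ),
        G.starWeight a b c (join β σ) =
          if G.SingleDir Hs a b c σ then tblAt (G.sigOf Hs a b c σ) (G.evOf a b c β) else 0 := by
      intro σ hσ
      simp only [Finset.mem_filter, Finset.mem_univ, true_and] at hσ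
      rw [starWeight_join hH hβ hσ]
      simp only [hbot, true_and]
    rw [Finset.sum_congr rfl hterm, ← Finset.sum_filter, Finset.filter_filter, starWeight_base hbot]
    set ev := G.evOf a b c β
    -- truncate the table
    have hlow : ∑ σ ∈ Finset.univ.filter (fun σ : Config E => G.HubOnly Hs σ ∧ G.SingleDir Hs a b c σ),
        tblLowAt (G.sigOf Hs a b c σ) ev ≤
        ∑ σ ∈ Finset.univ.filter (fun σ : Config E => G.HubOnly Hs σ ∧ G.SingleDir Hs a b c σ),
          tblAt (G.sigOf Hs a b c σ) ev :=
      Finset.sum_le_sum fun σ _ => tblLowAt_le _ _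
    rw [sum_tblLowAt] at hlow
    -- the arithmetic
    have h100 : 0 ≤ tblAt (true, false, false) ev := tbl_100_nonneg _ _ _ _ _
    have h010 : 0 ≤ tblAt (false, true, false) ev := tbl_010_nonneg _ _ _ _ _
    have hsum : tblAt (false, false, false) ev ≤
        tblAt (false, false, true) ev + tblAt (true, false, false) ev + tblAt (false, true, false) ev :=
      tbl_sum_ge _ _ _ _ _
    have hN1' : (G.sigCount Hs a b c (false, false, true) : ℤ) ≤ G.sigCount Hs a b c (true, false, false) := by
      exact_mod_cast hN1
    have hN2' : (G.sigCount Hs a b c (false, false, true) : ℤ) ≤ G.sigCount Hs a b c (false, true, false) := by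
      exact_mod_cast hN2
    have hN0 : (0 : ℤ) ≤ G.sigCount Hs a b c (false, false, true) := by positivity
    have e1 := mul_le_mul_of_nonneg_right hN1' h100
    have e2 := mul_le_mul_of_nonneg_right hN2' h010
    have e3 := mul_le_mul_of_nonneg_left hsum hN0
    push_cast
    nlinarith [hlow, e1, e2, e3]
  · -- nothing is `bot`
    have hzero : ∀ σ ∈ Finset.univ.filter (fun σ : Config E => G.HubOnly Hs σ),
        G.starWeight a b c (join β σ) = 0 := by
      intro σ hσ
      simp only [Finset.mem_filter, Finset.mem_univ, true_and] at hσ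
      rw [starWeight_join hH hβ hσ, if_neg (by rintro ⟨h, -⟩; exact hbot h)]
    rw [Finset.sum_congr rfl hzero, Finset.sum_const_zero]
    unfold starWeight
    rw [if_neg hbot, mul_zero]

end PerBase

end MultiGraph

end PercRepro
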